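import Literature.MathematicalPhysics.QuantumFieldTheory.Balaban1983to89.B4Thm110ZeroTorus

/-!
# B4 «Theorem (Proposition 2.1 of [1])», the clauses (1.10) at `A = 0` on the torus — AT EVERY LEVEL `k` IN THE PRINT'S OWN
# UNITS `η = L^{−k}`: rate `e^{−δ₀D/L^k}` and the `T_η` prefactors `(L^kε)²` (value) / `L^kε` (derivative)

statement-level skeleton of published theorems with citation tags; proofs where landed; nothing here is a claim about the
Yang–Mills mass gap

B4 = T. Bałaban, *Regularity and decay of lattice Green's functions*, Commun. Math. Phys. **89** (1983) 571–597
[cite: Balaban1983RegularityDecay] (journal page = PDF page + 570; held `paper:balaban1983-cmp89-regularity-decay`, pp. 572–573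
[PDF 2–3] and p. 582 [PDF 12] re-read by this seat); B1 = *(Higgs)₂,₃ quantum fields in a finite volume I*, Commun. Math. Phys. **85**
(1982) 603–636 [cite: Balaban1982Higgs1].  Cell `lit-balaban`, B4 fold owner r01 (gen 14); companion of p38's `B4Thm110ZeroTorus`
(imported, untouched), answering the units note of the C2 fold owner r18 (gen 19, 2026-08-22): the consumers of the torus member
(p31's `BIJ88NeumannPropagatorFlatDecay.decay110_flat`, C2 (2.30)/(2.31)) need the printed rate at every level `k ≤ K` of ONE
volume, not only at the top level.

## WHAT IS PRINTED (verbatim; `≦` written `≤`)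

* p. 572 [PDF 2]: «We consider operators on subsets of the lattice ηZ^d, η = L^{−k}. Here L is a small positive integer > 1, e.g.
  L = 2 or 3, and k is an arbitrary positive integer. Another common case is to consider operators on subsets of a torus T_η
  which we identify with a rectangular parallelepiped in ηZ^d with periodic conditions. The lattice ηZ^d is divided into unit
  cubes called blocks …»
* p. 573 [PDF 3]: «**Theorem** (Proposition 2.1 of [1]). For α < 1 there exist positive constants δ₀, c₀, R₀ independent of A,
  k, Ω and depending on d, M only, c₀ on α also, such that … Similarly |(D^η_{A,μ}G_k(Ω, A)f)(x)|, |(G_k(Ω, A)f)(x)| ≤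
  c₀ exp(−δ₀ dist(x, supp f))‖f‖_∞ (1.10) for x ∈ Ω, dist(x, Ω^c) ≥ R₀. … For some simple sets Ω, e.g. for rectangular
  parallelepipeds, the inequalities hold without any restrictions on the points x, x′, i.e. for all x, x′ ∈ Ω.»
* p. 582 [PDF 12]: (2.34) `G_k(□) = C^{(0),η}(□) + Σ_{j=1}^{k−1} a_j²(L^jη)^{−4}G^η_j(□)Q_j^*C^{(j),L^jη}(□)Q_jG^η_j(□)` and (2.38)–(2.39):
  every term «rescaled to the L^{−j}-lattice» carries a power of `L^jη ≤ 1`.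

## THE UNITS (why this file exists)

In the print the lattice is `ηZ^d` with `η = L^{−k}` and the `k`-blocks are UNIT cubes (p. 572), so `dist(x, supp f)` in (1.10) is the
fine lattice distance DIVIDED BY `L^k`, and `δ₀, c₀` are `k`-uniform in these units.  In Bałaban's concrete scalar torus tower
`B1RG242Torus.tower P a m²` (fine spacing `ε = L^{−K}`, levels `k ≤ K`) the level-`k` operator `G^ε_k` has `k`-blocks of side `L^kε`;
rescaling lengths by `(L^kε)^{−1}` puts it in the print's units: `G^ε_k = (L^kε)²·G_k^{resc}` (`B5Display136Torus.G_eq_smul_Grs`, the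
`(L^jη)²`-bookkeeping of (2.34)), `G_k^{resc} = B5Display136Torus.Grs P a m² k =` B4's `G_k(T_η, 0)` with `η = ε/(L^kε) = L^{−k}`, and
`∂^ε_μ = (L^kε)^{−1}D^η_μ`.  Hence the printed (1.10) for the tower reads, with `D` the fine sup-torus distance from `x` to `supp f`:
`|(G^ε_kf)(x)| ≤ c₀(L^kε)²e^{−δ₀D/L^k}‖f‖_∞`, `|(∂^ε_μG^ε_kf)(x)| ≤ c₀(L^kε)e^{−δ₀D/L^k}‖f‖_∞` — equivalently
`|(G_k^{resc}f)(x)|, |(D^η_μG_k^{resc}f)(x)| ≤ c₀e^{−δ₀·ηD}‖f‖_∞`.  p38's `thm110_zero_torus` concludes `c₀e^{−δ₀·εD}‖f‖_∞` for both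
members: this IS the printed statement at the top level `k = K` (`L^Kε = 1`, `εD = D/L^K`) — which is all the typed torus family
`B4ThmZeroTorusEta.torusEtaFam` uses — but at a level `k < K` of the same volume it is weaker by the factor `L^{k−K}` in the rate
(and by `(L^kε)^{−2}`, `(L^kε)^{−1}` in the size).  THERE IS NO OBSTRUCTION to the sharp form along p38's own route: the scale-`j`
term of (2.34) is bounded through `B4Thm110ZeroTorus.term_row_bound` by `c_term·e^{−(δ/4)D/L^j}` and `e^{−(δ/4)D/L^j} ≤ e^{−(δ/4)D/L^k}`
for `j < k` (p38's `exp_scale_le` spent this on `e^{−(δ/4)εD}`); the `C^{(0)}` term decays like `e^{−(δ₀/2)D} ≤ e^{−(δ₀/2)D/L^k}`; the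
prefactors are `a_j²(L^jε)² ≤ a²(L^jε)(L^kε)` resp. `a_j²(L^jε) ≤ a²(L^jε)` with `Σ_{1≤j<k}L^jε ≤ L^kε/(L−1)`, and `ε² ≤ (L^kε)²`
resp. `ε ≤ L^kε` for `j = 0`; the mass enters only through the level-free kernel constants (`KerBounds`, `G0unit_decay`).  The
constants obtained are p38's, verbatim.

## WHAT THIS FILE CERTIFIES (kernel-checked, zero `sorry`, theorems only)

* §1 scale bookkeeping: `sum_spacing_lt_le` (`Σ_{1≤j<k}L^jε ≤ L^kε/(L−1)`), `eps_le_spacing`, `exp_level_mono` (`e^{−cD/L^j} ≤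
  e^{−cD/L^k}`, `j ≤ k`), `exp_fine_le_level`, `exp_level_le_eps` (`e^{−cD/L^k} ≤ e^{−c·εD}`, `k ≤ K`).
* §2 at one volume from p38's kernel hypotheses `KerBounds`/`hG0`, for `1 ≤ k ≤ m + K` (no `k ≤ K` needed here):
  **`value_row_bound_level`** `|(G^ε_kf)(x)| ≤ (C₀K_d(δ₀/2) + a²c_term/(L−1))·(L^kε)²·e^{−min(δ₀/2,δ/4)·D/L^k}·F` and
  **`deriv_row_bound_level`** `|(∂^ε_μG^ε_kf)(x)| ≤ (2C₀e^{δ₀}K_d(δ₀/2) + a²c_term/(L−1))·(L^kε)·e^{−min(δ₀/2,δ/4)·D/L^k}·F` — p38's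
  `value_row_bound`/`deriv_row_bound` with the same constants, the prefactor `(L^kε)²`/`L^kε` gained and the rate in level-`k` units.
* §3 **`thm110_zero_torus_level`** — (1.10) ON THE TORUS AT `A = 0`, BOTH CLAUSES, HYPOTHESIS-FREE, UNIFORM IN THE VOLUME AND IN
  `1 ≤ k ≤ K`, IN THE PRINT'S UNITS: for `d ≥ 1`, odd `L > 1`, `a > 0`, `m² ≥ 0` there are `δ₀, c₀ > 0` (p38's) with
  `|(G^ε_kf)(x)| ≤ c₀(L^kε)²e^{−δ₀D/L^k}F` and `|(∂^ε_μG^ε_kf)(x)| ≤ c₀(L^kε)e^{−δ₀D/L^k}F` (p38's quantifier shape, a drop-in for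
  `decay110_flat`-type consumers); `thm110_zero_torus_level_kernel` (source `δ_y`: the kernel entries); **`thm110_zero_torus_resc`** —
  the VERBATIM (1.10) for B4's own `G_k(T_η, 0) = Grs P a m² k` and `D^η_μ = deriv P 0 (ε/(L^kε)) μ`:
  `|(G_k^{resc}f)(x)|, |(D^η_μG_k^{resc}f)(x)| ≤ c₀e^{−δ₀D/L^k}F`.  p38's `εD` form follows from §3 by `L^kε ≤ 1` and
  `exp_level_le_eps` (not restated: it is `B4Thm110ZeroTorus.thm110_zero_torus`).

## DICTIONARY / HONEST SCOPE

As in `B4Thm110ZeroTorus` (i)–(vi): `A = 0`, `U ≡ 1`, one component, `Ω = Ω₀ = T_η` (no `R₀`: the p. 573 parallelepiped sentence,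
periodic case of p. 572); sup torus metric in fine units (`B5Ineq137Torus.T`), `dist(x, supp f) ↦ D/L^k = ηD` for any
`0 ≤ D ≤ |x − z|_{T^{(0)}}` on `supp f` (the print's Euclidean `dist ≥` sup-dist, so the printed exponent follows with `δ₀/√d`); the
tower's mass term at level `k` is `(L^kε)²m² ≤ m²` (B4 (1.6) with a `k`-dependent mass under a fixed cap — constants depend on the cap
only); constants existential; route = the print's pp. 582–584 carried out on the torus (B5 p. 39 «with □ replaced by the whole torus»),
not the Sect. 2 random walk.  NOT CERTIFIED here: the Hölder clause (1.9) in level-`k` units (p38's `B4Thm19ZeroTorus` has the `εD`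
form), background fields, Neumann boxes (`B4Thm110ZeroBox*`, already in level-`k` units).
-/

namespace Literature.MathematicalPhysics.QuantumFieldTheory.Balaban1983to89

namespace B4Thm110ZeroTorusLevel

open Matrix B1RG242Torus B5Display136Torus B5Leaf237C0Torus B4Ineq115Torus B5Ineq137Torus B4Ineq116Torus
  B4Thm110ZeroTorus

/-! ## §1 Scale bookkeeping in level-`k` units -/

section Scales

variable (P : Params)

/-- `Σ_{1 ≤ j < k} L^jε ≤ L^kε/(L − 1)` (geometric sum; the scale factors of (2.39) summed up to the level `k`).
[cite: Balaban1983RegularityDecay, (2.39) p.582; scale bookkeeping] -/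
theorem sum_spacing_lt_le (k : ℕ) : ∑ j ∈ Finset.Ico 1 k, P.spacing j ≤ P.spacing k / ((P.L : ℝ) - 1) := by
  have hL1 : (1 : ℝ) < P.L := one_lt_cast_L P
  have hε : 0 < P.eps := P.eps_pos
  have hgeom : ∑ j ∈ Finset.range k, (P.L : ℝ) ^ j = ((P.L : ℝ) ^ k - 1) / ((P.L : ℝ) - 1) :=
    geom_sum_eq hL1.ne' k
  calc ∑ j ∈ Finset.Ico 1 k, P.spacing j
      ≤ ∑ j ∈ Finset.range k, P.spacing j := by
        refine Finset.sum_le_sum_of_subset_of_nonneg (fun j hj => ?_) (fun j _ _ => (P.spacing_pos j).le)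
        exact Finset.mem_range.mpr (Finset.mem_Ico.mp hj).2
    _ = P.eps * ∑ j ∈ Finset.range k, (P.L : ℝ) ^ j := by
        rw [Finset.mul_sum]
        exact Finset.sum_congr rfl fun j _ => by unfold Params.spacing; ring
    _ = P.eps * (((P.L : ℝ) ^ k - 1) / ((P.L : ℝ) - 1)) := by rw [hgeom]
    _ ≤ P.eps * ((P.L : ℝ) ^ k / ((P.L : ℝ) - 1)) := by
        refine mul_le_mul_of_nonneg_left (div_le_div_of_nonneg_right (by linarith) (by linarith)) hε.le
    _ = P.spacing k / ((P.L : ℝ) - 1) := by unfold Params.spacing; ring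

/-- `ε ≤ L^kε`: the fine spacing is the smallest of the series (the `j = 0` scale factor of (2.39)).
[cite: Balaban1983RegularityDecay, (2.39) p.582; scale bookkeeping] -/
theorem eps_le_spacing (k : ℕ) : P.eps ≤ P.spacing k := by
  rw [← P.spacing_zero]; exact spacing_le_spacing P (Nat.zero_le k)

/-- A decay on the scale `D/L^j` is at least a decay on the coarser scale `D/L^k`, `j ≤ k`: `e^{−cD/L^j} ≤ e^{−cD/L^k}` (`c, D ≥ 0`)
— each scale-`j` term of (2.34), `j < k`, decays at least at the level-`k` rate. [cite: Balaban1983RegularityDecay, (2.38)–(2.39)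
p.582 with (1.10) p.573; scale bookkeeping] -/
theorem exp_level_mono {j k : ℕ} (hjk : j ≤ k) {c D : ℝ} (hc : 0 ≤ c) (hD : 0 ≤ D) :
    Real.exp (-(c * (D / (P.L : ℝ) ^ j))) ≤ Real.exp (-(c * (D / (P.L : ℝ) ^ k))) := by
  have hL1 : (1 : ℝ) < P.L := one_lt_cast_L P
  have hLj : 0 < (P.L : ℝ) ^ j := pow_pos P.cast_L_pos j
  have hdiv : D / (P.L : ℝ) ^ k ≤ D / (P.L : ℝ) ^ j :=
    div_le_div_of_nonneg_left hD hLj (pow_le_pow_right₀ hL1.le hjk)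
  exact Real.exp_le_exp.mpr (by nlinarith [mul_le_mul_of_nonneg_left hdiv hc])

/-- The `j = 0` case: a decay in the fine distance is at least a decay on the scale `D/L^k`: `e^{−cD} ≤ e^{−cD/L^k}`.
[cite: Balaban1983RegularityDecay, (2.38) p.582 (the `C^{(0),η}` term) with (1.10) p.573; scale bookkeeping] -/
theorem exp_fine_le_level (k : ℕ) {c D : ℝ} (hc : 0 ≤ c) (hD : 0 ≤ D) :
    Real.exp (-(c * D)) ≤ Real.exp (-(c * (D / (P.L : ℝ) ^ k))) := by
  have h := exp_level_mono P (Nat.zero_le k) hc hD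
  rwa [pow_zero, div_one] at h

/-- For `k ≤ K` the level-`k` rate dominates the `ε`-rate: `εD ≤ D/L^k` (`L^kε ≤ L^Kε = 1`), so `e^{−cD/L^k} ≤ e^{−c·εD}` — p38's
`B4Thm110ZeroTorus.thm110_zero_torus` is implied by the level-`k` form below. [cite: Balaban1983RegularityDecay, (2.39) p.582; scale
bookkeeping] -/
theorem exp_level_le_eps {k : ℕ} (hk : k ≤ P.K) {c D : ℝ} (hc : 0 ≤ c) (hD : 0 ≤ D) :
    Real.exp (-(c * (D / (P.L : ℝ) ^ k))) ≤ Real.exp (-(c * (P.eps * D))) := by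
  have hLk : 0 < (P.L : ℝ) ^ k := pow_pos P.cast_L_pos k
  have hsk : P.spacing k ≤ 1 := by rw [← P.spacing_K]; exact spacing_le_spacing P hk
  apply Real.exp_le_exp.mpr
  have h1 : P.eps * D ≤ D / (P.L : ℝ) ^ k := by
    rw [le_div_iff₀ hLk]
    have : P.spacing k * D ≤ 1 * D := mul_le_mul_of_nonneg_right hsk hD
    unfold Params.spacing at this
    nlinarith
  nlinarith [mul_le_mul_of_nonneg_left h1 hc]

end Scales

/-! ## §2 The two clauses of (1.10) at one volume from the kernel bounds, in level-`k` units -/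

section Rows

variable (P : Params)

/-- **(1.10) ON THE TORUS, VALUE CLAUSE, LEVEL-`k` UNITS** (one volume, `1 ≤ k ≤ m + K`): under p38's kernel hypotheses
(`KerBounds`: (2.35) both quantities and (2.37) at rate `δ`; `hG0`: the `C^{(0)}` kernel at rate `δ₀`), for every `f` with `|f| ≤ F`
vanishing within fine distance `D ≥ 0` of `x`,
`|(G^ε_k f)(x)| ≤ (C₀K_d(δ₀/2) + a²·c_term/(L−1))·(L^kε)²·e^{−min(δ₀/2, δ/4)·D/L^k}·F`.  Route: (2.34) at kernel level
(`B4Thm110ZeroTorus.G_apply_eq`); the `j = 0` term by `fine_row_sum` with `ε² ≤ (L^kε)²` and `e^{−(δ₀/2)D} ≤ e^{−(δ₀/2)D/L^k}`; the terms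
`1 ≤ j < k` by `term_row_bound` (`c_term·e^{−(δ/4)D/L^j}`) with `e^{−(δ/4)D/L^j} ≤ e^{−(δ/4)D/L^k}`, `a_j²(L^jε)² ≤ a²(L^jε)(L^kε)` and
`Σ_{1≤j<k}L^jε ≤ L^kε/(L−1)`. [cite: Balaban1983RegularityDecay, Theorem (1.10) p.573 («|(G_k(Ω,A)f)(x)| ≤ c₀exp(−δ₀dist(x,supp f))‖f‖_∞»,
η = L^{−k} p.572, «for rectangular parallelepipeds … for all x»), proof route pp.582–584 (2.34), (2.38)–(2.39), Lemma 2.4, p.572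
(torus)] -/
theorem value_row_bound_level {a msq : ℝ} (ha : 0 < a) (hm : 0 ≤ msq) {k : ℕ} (hk1 : 1 ≤ k)
    (hkm : k ≤ P.m + P.K) {C δ C₀ δ₀ : ℝ} (hC : 0 ≤ C) (hδ : 0 < δ) (hC₀ : 0 ≤ C₀) (hδ₀ : 0 < δ₀)
    (hK : KerBounds P a msq k C δ)
    (hG0 : ∀ x x' : Site P 0, |G0unit P a msq x x'| ≤ C₀ * Real.exp (-(δ₀ * T P 0 x x')))
    (x : Site P 0) (f : Site P 0 → ℝ) {F D : ℝ} (hF : ∀ z, |f z| ≤ F) (hD0 : 0 ≤ D)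
    (hD : ∀ z, f z ≠ 0 → D ≤ T P 0 x z) :
    |((tower P a msq).G k *ᵥ f) x|
      ≤ (C₀ * B4Sect5Proof.latticeConst P.d (δ₀ / 2) + a ^ 2 * cTerm P.d C δ * (1 / ((P.L : ℝ) - 1))) *
          P.spacing k ^ 2 * Real.exp (-(min (δ₀ / 2) (δ / 4) * (D / (P.L : ℝ) ^ k))) * F := by
  have hL1 : (1 : ℝ) < P.L := one_lt_cast_L P
  have hε0 : 0 < P.eps := P.eps_pos
  have hF0 : 0 ≤ F := (abs_nonneg _).trans (hF x)
  have hct : 0 ≤ cTerm P.d C δ := cTerm_nonneg P.d hC hδ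
  have hsk0 : 0 ≤ P.spacing k := (P.spacing_pos k).le
  have hLk : 0 < (P.L : ℝ) ^ k := pow_pos P.cast_L_pos k
  have hDk : 0 ≤ D / (P.L : ℝ) ^ k := div_nonneg hD0 hLk.le
  set m₀ := min (δ₀ / 2) (δ / 4) with hm₀
  have hm₀0 : 0 ≤ m₀ := le_min (by positivity) (by positivity)
  set E := Real.exp (-(m₀ * (D / (P.L : ℝ) ^ k))) with hEdef
  have hE0 : 0 ≤ E := (Real.exp_pos _).le
  -- split (G f)(x) along (2.34)
  have hsplit : ((tower P a msq).G k *ᵥ f) x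
      = P.eps ^ 2 * ∑ x', G0unit P a msq x x' * f x'
        + ∑ j ∈ Finset.Ico 1 k, B1.aSeq a P.L j ^ 2 * P.spacing j ^ 2 *
            ∑ x', (∑ y : Site P j, ∑ y' : Site P j,
              (Grs P a msq j * Qks P j) x y * Crs P a msq j y y' * (Qk P j * Grs P a msq j) y' x') * f x' := by
    have e1 : ((tower P a msq).G k *ᵥ f) x = ∑ x', (tower P a msq).G k x x' * f x' := rfl
    rw [e1]
    calc ∑ x', (tower P a msq).G k x x' * f x'
        = ∑ x', (P.eps ^ 2 * G0unit P a msq x x' * f x' +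
            ∑ j ∈ Finset.Ico 1 k, B1.aSeq a P.L j ^ 2 * P.spacing j ^ 2 *
              (∑ y : Site P j, ∑ y' : Site P j,
                (Grs P a msq j * Qks P j) x y * Crs P a msq j y y' * (Qk P j * Grs P a msq j) y' x') * f x') := by
          refine Finset.sum_congr rfl fun x' _ => ?_
          rw [G_apply_eq P ha hm hk1, add_mul, Finset.sum_mul]
      _ = _ := by
          rw [Finset.sum_add_distrib, Finset.sum_comm, Finset.mul_sum]
          congr 1
          · exact Finset.sum_congr rfl fun x' _ => by ring
          · refine Finset.sum_congr rfl fun j _ => ?_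
            rw [Finset.mul_sum]
            exact Finset.sum_congr rfl fun x' _ => by ring
  -- the j = 0 row: ε² ≤ (L^kε)² and e^{−(δ₀/2)D} ≤ e^{−m₀D/L^k}
  have h0 : |P.eps ^ 2 * ∑ x', G0unit P a msq x x' * f x'|
      ≤ C₀ * B4Sect5Proof.latticeConst P.d (δ₀ / 2) * P.spacing k ^ 2 * E * F := by
    have hrow := fine_row_sum P hδ₀ x f hF hD
    have hε2 : P.eps ^ 2 ≤ P.spacing k ^ 2 := pow_le_pow_left₀ hε0.le (eps_le_spacing P k) 2
    have hexp : Real.exp (-(δ₀ / 2 * D)) ≤ E := by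
      refine (exp_fine_le_level P k (show 0 ≤ δ₀ / 2 by positivity) hD0).trans ?_
      rw [hEdef]
      exact Real.exp_le_exp.mpr (by nlinarith [mul_le_mul_of_nonneg_right (min_le_left (δ₀ / 2) (δ / 4)) hDk])
    have hR := B4Sect5Proof.latticeConst_nonneg P.d (show 0 ≤ δ₀ / 2 by positivity)
    calc |P.eps ^ 2 * ∑ x', G0unit P a msq x x' * f x'|
        = P.eps ^ 2 * |∑ x', G0unit P a msq x x' * f x'| := by rw [abs_mul, abs_of_nonneg (by positivity)]
      _ ≤ P.spacing k ^ 2 * (∑ x', Real.exp (-(δ₀ * T P 0 x x')) * |f x'| * C₀) := by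
          refine mul_le_mul hε2 ?_ (abs_nonneg _) (by positivity)
          calc |∑ x', G0unit P a msq x x' * f x'| ≤ ∑ x', |G0unit P a msq x x' * f x'| :=
                Finset.abs_sum_le_sum_abs _ _
            _ ≤ ∑ x', Real.exp (-(δ₀ * T P 0 x x')) * |f x'| * C₀ := by
                refine Finset.sum_le_sum fun x' _ => ?_
                rw [abs_mul]
                calc |G0unit P a msq x x'| * |f x'| ≤ C₀ * Real.exp (-(δ₀ * T P 0 x x')) * |f x'| :=
                      mul_le_mul_of_nonneg_right (hG0 x x') (abs_nonneg _)
                  _ = _ := by ring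
      _ = P.spacing k ^ 2 * (C₀ * ∑ x', Real.exp (-(δ₀ * T P 0 x x')) * |f x'|) := by
          rw [← Finset.sum_mul]; ring
      _ ≤ P.spacing k ^ 2 * (C₀ * (F * B4Sect5Proof.latticeConst P.d (δ₀ / 2) * Real.exp (-(δ₀ / 2 * D)))) :=
          mul_le_mul_of_nonneg_left (mul_le_mul_of_nonneg_left hrow hC₀) (by positivity)
      _ ≤ P.spacing k ^ 2 * (C₀ * (F * B4Sect5Proof.latticeConst P.d (δ₀ / 2) * E)) :=
          mul_le_mul_of_nonneg_left (mul_le_mul_of_nonneg_left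
            (mul_le_mul_of_nonneg_left hexp (by positivity)) hC₀) (by positivity)
      _ = _ := by ring
  -- the rows j ≥ 1: a_j²(L^jε)² ≤ a²(L^jε)(L^kε) and e^{−(δ/4)D/L^j} ≤ e^{−m₀D/L^k}
  have hj : ∀ j ∈ Finset.Ico 1 k,
      |B1.aSeq a P.L j ^ 2 * P.spacing j ^ 2 *
          ∑ x', (∑ y : Site P j, ∑ y' : Site P j,
            (Grs P a msq j * Qks P j) x y * Crs P a msq j y y' * (Qk P j * Grs P a msq j) y' x') * f x'|
        ≤ a ^ 2 * cTerm P.d C δ * E * F * P.spacing k * P.spacing j := by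
    intro j hjm
    obtain ⟨hj1, hjk⟩ := Finset.mem_Ico.mp hjm
    have ht := term_row_bound P hC hδ hK hj1 hjk hkm x (fun z y => (Grs P a msq j * Qks P j) z y)
      (hK.gq j hj1 hjk) f hF hD
    have haj : B1.aSeq a P.L j ^ 2 ≤ a ^ 2 := by
      have := B5Leaf235Torus.abs_aSeq_le ha hL1 j
      rw [← sq_abs]; exact pow_le_pow_left₀ (abs_nonneg _) this 2
    have hs0 : 0 ≤ P.spacing j := (P.spacing_pos j).le
    have hsjk : P.spacing j ≤ P.spacing k := spacing_le_spacing P hjk.le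
    have hs2 : P.spacing j ^ 2 ≤ P.spacing k * P.spacing j := by
      rw [sq]; exact mul_le_mul_of_nonneg_right hsjk hs0
    have hexp : Real.exp (-(δ / 4 * (D / (P.L : ℝ) ^ j))) ≤ E := by
      refine (exp_level_mono P hjk.le (show 0 ≤ δ / 4 by positivity) hD0).trans ?_
      rw [hEdef]
      exact Real.exp_le_exp.mpr (by nlinarith [mul_le_mul_of_nonneg_right (min_le_right (δ₀ / 2) (δ / 4)) hDk])
    rw [abs_mul, abs_of_nonneg (by positivity)]
    calc B1.aSeq a P.L j ^ 2 * P.spacing j ^ 2 *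
          |∑ x', (∑ y : Site P j, ∑ y' : Site P j,
            (Grs P a msq j * Qks P j) x y * Crs P a msq j y y' * (Qk P j * Grs P a msq j) y' x') * f x'|
        ≤ a ^ 2 * (P.spacing k * P.spacing j) * (cTerm P.d C δ * E * F) :=
          mul_le_mul (mul_le_mul haj hs2 (by positivity) (by positivity))
            (ht.trans (mul_le_mul_of_nonneg_right (mul_le_mul_of_nonneg_left hexp hct) hF0)) (abs_nonneg _)
            (by positivity)
      _ = _ := by ring
  rw [hsplit]
  calc |P.eps ^ 2 * ∑ x', G0unit P a msq x x' * f x' +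
        ∑ j ∈ Finset.Ico 1 k, B1.aSeq a P.L j ^ 2 * P.spacing j ^ 2 *
          ∑ x', (∑ y : Site P j, ∑ y' : Site P j,
            (Grs P a msq j * Qks P j) x y * Crs P a msq j y y' * (Qk P j * Grs P a msq j) y' x') * f x'|
      ≤ |P.eps ^ 2 * ∑ x', G0unit P a msq x x' * f x'| +
        ∑ j ∈ Finset.Ico 1 k, |B1.aSeq a P.L j ^ 2 * P.spacing j ^ 2 *
          ∑ x', (∑ y : Site P j, ∑ y' : Site P j,
            (Grs P a msq j * Qks P j) x y * Crs P a msq j y y' * (Qk P j * Grs P a msq j) y' x') * f x'| :=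
        (abs_add_le _ _).trans (add_le_add le_rfl (Finset.abs_sum_le_sum_abs _ _))
    _ ≤ C₀ * B4Sect5Proof.latticeConst P.d (δ₀ / 2) * P.spacing k ^ 2 * E * F +
        ∑ j ∈ Finset.Ico 1 k, a ^ 2 * cTerm P.d C δ * E * F * P.spacing k * P.spacing j :=
        add_le_add h0 (Finset.sum_le_sum hj)
    _ = C₀ * B4Sect5Proof.latticeConst P.d (δ₀ / 2) * P.spacing k ^ 2 * E * F +
        a ^ 2 * cTerm P.d C δ * E * F * P.spacing k * ∑ j ∈ Finset.Ico 1 k, P.spacing j := by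
        rw [Finset.mul_sum]
    _ ≤ C₀ * B4Sect5Proof.latticeConst P.d (δ₀ / 2) * P.spacing k ^ 2 * E * F +
        a ^ 2 * cTerm P.d C δ * E * F * P.spacing k * (P.spacing k / ((P.L : ℝ) - 1)) :=
        add_le_add le_rfl (mul_le_mul_of_nonneg_left (sum_spacing_lt_le P k)
          (by positivity : (0 : ℝ) ≤ a ^ 2 * cTerm P.d C δ * E * F * P.spacing k))
    _ = _ := by ring

/-- **(1.10) ON THE TORUS, DERIVATIVE CLAUSE, LEVEL-`k` UNITS** (one volume, `1 ≤ k ≤ m + K`): under the same hypotheses, for every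
direction `μ`, `|(∂^ε_μG^ε_k f)(x)| ≤ (2C₀e^{δ₀}K_d(δ₀/2) + a²·c_term/(L−1))·(L^kε)·e^{−min(δ₀/2, δ/4)·D/L^k}·F` — one power of `L^jε`
per term (B4 (2.38)), summed to `L^kε/(L−1)`; the `j = 0` term `ε·∂¹G_0^{unit}` with `ε ≤ L^kε`. [cite: Balaban1983RegularityDecay,
Theorem (1.10) p.573 («|(D^η_{A,μ}G_k(Ω,A)f)(x)| ≤ c₀exp(−δ₀dist(x,supp f))‖f‖_∞», η = L^{−k} p.572), proof route pp.582–584 (2.34),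
(2.38)–(2.39), Lemma 2.4, p.572 (torus)] -/
theorem deriv_row_bound_level {a msq : ℝ} (ha : 0 < a) (hm : 0 ≤ msq) {k : ℕ} (hk1 : 1 ≤ k)
    (hkm : k ≤ P.m + P.K) {C δ C₀ δ₀ : ℝ} (hC : 0 ≤ C) (hδ : 0 < δ) (hC₀ : 0 ≤ C₀) (hδ₀ : 0 < δ₀)
    (hK : KerBounds P a msq k C δ)
    (hG0 : ∀ x x' : Site P 0, |G0unit P a msq x x'| ≤ C₀ * Real.exp (-(δ₀ * T P 0 x x')))
    (μ : Fin P.d) (x : Site P 0) (f : Site P 0 → ℝ) {F D : ℝ} (hF : ∀ z, |f z| ≤ F) (hD0 : 0 ≤ D)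
    (hD : ∀ z, f z ≠ 0 → D ≤ T P 0 x z) :
    |((deriv P 0 P.eps μ * (tower P a msq).G k) *ᵥ f) x|
      ≤ (2 * C₀ * Real.exp δ₀ * B4Sect5Proof.latticeConst P.d (δ₀ / 2) +
          a ^ 2 * cTerm P.d C δ * (1 / ((P.L : ℝ) - 1))) *
          P.spacing k * Real.exp (-(min (δ₀ / 2) (δ / 4) * (D / (P.L : ℝ) ^ k))) * F := by
  have hL1 : (1 : ℝ) < P.L := one_lt_cast_L P
  have hε0 : 0 < P.eps := P.eps_pos
  have hF0 : 0 ≤ F := (abs_nonneg _).trans (hF x)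
  have hct : 0 ≤ cTerm P.d C δ := cTerm_nonneg P.d hC hδ
  have hsk0 : 0 ≤ P.spacing k := (P.spacing_pos k).le
  have hLk : 0 < (P.L : ℝ) ^ k := pow_pos P.cast_L_pos k
  have hDk : 0 ≤ D / (P.L : ℝ) ^ k := div_nonneg hD0 hLk.le
  set m₀ := min (δ₀ / 2) (δ / 4) with hm₀
  have hm₀0 : 0 ≤ m₀ := le_min (by positivity) (by positivity)
  set E := Real.exp (-(m₀ * (D / (P.L : ℝ) ^ k))) with hEdef
  have hE0 : 0 ≤ E := (Real.exp_pos _).le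
  -- split (∂G f)(x) along (2.34)
  have hsplit : ((deriv P 0 P.eps μ * (tower P a msq).G k) *ᵥ f) x
      = P.eps * ∑ x', (deriv P 0 1 μ * G0unit P a msq) x x' * f x'
        + ∑ j ∈ Finset.Ico 1 k, B1.aSeq a P.L j ^ 2 * P.spacing j *
            ∑ x', (∑ y : Site P j, ∑ y' : Site P j,
              K1 P a msq j μ x ⟨j, y⟩ * Crs P a msq j y y' * (Qk P j * Grs P a msq j) y' x') * f x' := by
    have e1 : ((deriv P 0 P.eps μ * (tower P a msq).G k) *ᵥ f) x
        = ∑ x', (deriv P 0 P.eps μ * (tower P a msq).G k) x x' * f x' := rfl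
    rw [e1]
    calc ∑ x', (deriv P 0 P.eps μ * (tower P a msq).G k) x x' * f x'
        = ∑ x', (P.eps * (deriv P 0 1 μ * G0unit P a msq) x x' * f x' +
            ∑ j ∈ Finset.Ico 1 k, B1.aSeq a P.L j ^ 2 * P.spacing j *
              (∑ y : Site P j, ∑ y' : Site P j,
                K1 P a msq j μ x ⟨j, y⟩ * Crs P a msq j y y' * (Qk P j * Grs P a msq j) y' x') * f x') := by
          refine Finset.sum_congr rfl fun x' _ => ?_
          rw [derivG_apply_eq P ha hm hk1, add_mul, Finset.sum_mul]
      _ = _ := by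
          rw [Finset.sum_add_distrib, Finset.sum_comm, Finset.mul_sum]
          congr 1
          · exact Finset.sum_congr rfl fun x' _ => by ring
          · refine Finset.sum_congr rfl fun j _ => ?_
            rw [Finset.mul_sum]
            exact Finset.sum_congr rfl fun x' _ => by ring
  -- the j = 0 row: ε ≤ L^kε and e^{−(δ₀/2)D} ≤ e^{−m₀D/L^k}
  have h0 : |P.eps * ∑ x', (deriv P 0 1 μ * G0unit P a msq) x x' * f x'|
      ≤ 2 * C₀ * Real.exp δ₀ * B4Sect5Proof.latticeConst P.d (δ₀ / 2) * P.spacing k * E * F := by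
    have hrow := fine_row_sum P hδ₀ x f hF hD
    have hε1 : P.eps ≤ P.spacing k := eps_le_spacing P k
    have hexp : Real.exp (-(δ₀ / 2 * D)) ≤ E := by
      refine (exp_fine_le_level P k (show 0 ≤ δ₀ / 2 by positivity) hD0).trans ?_
      rw [hEdef]
      exact Real.exp_le_exp.mpr (by nlinarith [mul_le_mul_of_nonneg_right (min_le_left (δ₀ / 2) (δ / 4)) hDk])
    have hdb := derivG0unit_bound P hC₀ hδ₀ hG0 μ x
    have hR := B4Sect5Proof.latticeConst_nonneg P.d (show 0 ≤ δ₀ / 2 by positivity)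
    calc |P.eps * ∑ x', (deriv P 0 1 μ * G0unit P a msq) x x' * f x'|
        = P.eps * |∑ x', (deriv P 0 1 μ * G0unit P a msq) x x' * f x'| := by rw [abs_mul, abs_of_nonneg hε0.le]
      _ ≤ P.spacing k * (∑ x', Real.exp (-(δ₀ * T P 0 x x')) * |f x'| * (2 * C₀ * Real.exp δ₀)) := by
          refine mul_le_mul hε1 ?_ (abs_nonneg _) hsk0
          calc |∑ x', (deriv P 0 1 μ * G0unit P a msq) x x' * f x'|
              ≤ ∑ x', |(deriv P 0 1 μ * G0unit P a msq) x x' * f x'| := Finset.abs_sum_le_sum_abs _ _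
            _ ≤ ∑ x', Real.exp (-(δ₀ * T P 0 x x')) * |f x'| * (2 * C₀ * Real.exp δ₀) := by
                refine Finset.sum_le_sum fun x' _ => ?_
                rw [abs_mul]
                calc |(deriv P 0 1 μ * G0unit P a msq) x x'| * |f x'|
                    ≤ 2 * C₀ * Real.exp δ₀ * Real.exp (-(δ₀ * T P 0 x x')) * |f x'| :=
                      mul_le_mul_of_nonneg_right (hdb x') (abs_nonneg _)
                  _ = _ := by ring
      _ = P.spacing k * (2 * C₀ * Real.exp δ₀ * ∑ x', Real.exp (-(δ₀ * T P 0 x x')) * |f x'|) := by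
          rw [← Finset.sum_mul]; ring
      _ ≤ P.spacing k * (2 * C₀ * Real.exp δ₀ *
            (F * B4Sect5Proof.latticeConst P.d (δ₀ / 2) * Real.exp (-(δ₀ / 2 * D)))) :=
          mul_le_mul_of_nonneg_left (mul_le_mul_of_nonneg_left hrow (by positivity)) hsk0
      _ ≤ P.spacing k * (2 * C₀ * Real.exp δ₀ * (F * B4Sect5Proof.latticeConst P.d (δ₀ / 2) * E)) :=
          mul_le_mul_of_nonneg_left (mul_le_mul_of_nonneg_left
            (mul_le_mul_of_nonneg_left hexp (by positivity)) (by positivity)) hsk0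
      _ = _ := by ring
  -- the rows j ≥ 1: a_j² ≤ a², e^{−(δ/4)D/L^j} ≤ e^{−m₀D/L^k}
  have hj : ∀ j ∈ Finset.Ico 1 k,
      |B1.aSeq a P.L j ^ 2 * P.spacing j *
          ∑ x', (∑ y : Site P j, ∑ y' : Site P j,
            K1 P a msq j μ x ⟨j, y⟩ * Crs P a msq j y y' * (Qk P j * Grs P a msq j) y' x') * f x'|
        ≤ a ^ 2 * cTerm P.d C δ * E * F * P.spacing j := by
    intro j hjm
    obtain ⟨hj1, hjk⟩ := Finset.mem_Ico.mp hjm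
    have ht := term_row_bound P hC hδ hK hj1 hjk hkm x (fun z y => K1 P a msq j μ z ⟨j, y⟩)
      (hK.k1 j hj1 hjk μ) f hF hD
    have haj : B1.aSeq a P.L j ^ 2 ≤ a ^ 2 := by
      have := B5Leaf235Torus.abs_aSeq_le ha hL1 j
      rw [← sq_abs]; exact pow_le_pow_left₀ (abs_nonneg _) this 2
    have hs0 : 0 ≤ P.spacing j := (P.spacing_pos j).le
    have hexp : Real.exp (-(δ / 4 * (D / (P.L : ℝ) ^ j))) ≤ E := by
      refine (exp_level_mono P hjk.le (show 0 ≤ δ / 4 by positivity) hD0).trans ?_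
      rw [hEdef]
      exact Real.exp_le_exp.mpr (by nlinarith [mul_le_mul_of_nonneg_right (min_le_right (δ₀ / 2) (δ / 4)) hDk])
    rw [abs_mul, abs_of_nonneg (by positivity)]
    calc B1.aSeq a P.L j ^ 2 * P.spacing j *
          |∑ x', (∑ y : Site P j, ∑ y' : Site P j,
            K1 P a msq j μ x ⟨j, y⟩ * Crs P a msq j y y' * (Qk P j * Grs P a msq j) y' x') * f x'|
        ≤ a ^ 2 * P.spacing j * (cTerm P.d C δ * E * F) :=
          mul_le_mul (mul_le_mul haj le_rfl hs0 (by positivity))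
            (ht.trans (mul_le_mul_of_nonneg_right (mul_le_mul_of_nonneg_left hexp hct) hF0)) (abs_nonneg _)
            (by positivity)
      _ = _ := by ring
  rw [hsplit]
  calc |P.eps * ∑ x', (deriv P 0 1 μ * G0unit P a msq) x x' * f x' +
        ∑ j ∈ Finset.Ico 1 k, B1.aSeq a P.L j ^ 2 * P.spacing j *
          ∑ x', (∑ y : Site P j, ∑ y' : Site P j,
            K1 P a msq j μ x ⟨j, y⟩ * Crs P a msq j y y' * (Qk P j * Grs P a msq j) y' x') * f x'|
      ≤ |P.eps * ∑ x', (deriv P 0 1 μ * G0unit P a msq) x x' * f x'| +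
        ∑ j ∈ Finset.Ico 1 k, |B1.aSeq a P.L j ^ 2 * P.spacing j *
          ∑ x', (∑ y : Site P j, ∑ y' : Site P j,
            K1 P a msq j μ x ⟨j, y⟩ * Crs P a msq j y y' * (Qk P j * Grs P a msq j) y' x') * f x'| :=
        (abs_add_le _ _).trans (add_le_add le_rfl (Finset.abs_sum_le_sum_abs _ _))
    _ ≤ 2 * C₀ * Real.exp δ₀ * B4Sect5Proof.latticeConst P.d (δ₀ / 2) * P.spacing k * E * F +
        ∑ j ∈ Finset.Ico 1 k, a ^ 2 * cTerm P.d C δ * E * F * P.spacing j :=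
        add_le_add h0 (Finset.sum_le_sum hj)
    _ = 2 * C₀ * Real.exp δ₀ * B4Sect5Proof.latticeConst P.d (δ₀ / 2) * P.spacing k * E * F +
        a ^ 2 * cTerm P.d C δ * E * F * ∑ j ∈ Finset.Ico 1 k, P.spacing j := by
        rw [Finset.mul_sum]
    _ ≤ 2 * C₀ * Real.exp δ₀ * B4Sect5Proof.latticeConst P.d (δ₀ / 2) * P.spacing k * E * F +
        a ^ 2 * cTerm P.d C δ * E * F * (P.spacing k / ((P.L : ℝ) - 1)) :=
        add_le_add le_rfl (mul_le_mul_of_nonneg_left (sum_spacing_lt_le P k)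
          (by positivity : (0 : ℝ) ≤ a ^ 2 * cTerm P.d C δ * E * F))
    _ = _ := by ring

end Rows

/-! ## §3 (1.10) on the torus at `A = 0` in the print's units, uniformly in the volume and in the level -/

section Uniform

/-- **B4 THEOREM (1.10) ON THE TORUS AT `A = 0`, IN THE PRINT'S UNITS `η = L^{−k}` — VALUE AND DERIVATIVE CLAUSES, UNIFORMLY IN THE
VOLUME AND IN THE LEVEL.**  For `d ≥ 1`, odd `L > 1`, `a > 0` and `m² ≥ 0` there are `δ₀ > 0`, `c₀ > 0` (functions of `d, L, a, m²`
only: «independent of A, k, Ω»; the same constants as `B4Thm110ZeroTorus.thm110_zero_torus`) such that for EVERY volume `P = (d, L, m, K)`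
of Bałaban's scalar torus tower, every level `1 ≤ k ≤ K`, every fine site `x`, every direction `μ` and every source `f` with `|f| ≤ F`
vanishing within fine sup-torus distance `D ≥ 0` of `x`:
`|(G^ε_k f)(x)| ≤ c₀(L^kε)²e^{−δ₀D/L^k}F` and `|(∂^ε_μG^ε_k f)(x)| ≤ c₀(L^kε)e^{−δ₀D/L^k}F`
— the printed `|(D^η_μG_kf)(x)|, |(G_kf)(x)| ≤ c₀exp(−δ₀dist(x, supp f))‖f‖_∞` for `G_k(T_η, 0)`, `η = L^{−k}`, read on the tower through
`G^ε_k = (L^kε)²G_k(T_η,0)`, `∂^ε = (L^kε)^{−1}D^η`, `dist_η = D/L^k` (`B4Thm110ZeroTorus` had the rate `e^{−δ₀εD}`, print's at `k = K`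
only; `εD ≤ D/L^k` and `L^kε ≤ 1`, so that form follows from this one: `exp_level_le_eps`).  ROUTE: p38's — (2.34) with Lemma 2.4 on the
torus (`B4Thm110ZeroTorus.kerBounds_torus`) and the `C^{(0)}` kernel (`B5Leaf237C0Torus.G0unit_decay`) — through §2.
[cite: Balaban1983RegularityDecay, Theorem (1.10) p.573, η = L^{−k} and the torus p.572, (2.34)–(2.39) p.582, p.584 («This part of the
argument is valid for an arbitrary rectangular parallelepiped»); Balaban1984PropagatorsI p.39 («with □ replaced by the whole torus»)] -/
theorem thm110_zero_torus_level (d L : ℕ) (hd : 1 ≤ d) (hL : Odd L ∧ 1 < L) {a : ℝ} (ha : 0 < a) {msq : ℝ}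
    (hmsq : 0 ≤ msq) :
    ∃ δ₀ c₀ : ℝ, 0 < δ₀ ∧ 0 < c₀ ∧ ∀ (P : Params), P.d = d → P.L = L →
      ∀ k : ℕ, 1 ≤ k → k ≤ P.K → ∀ (x : Site P 0) (f : Site P 0 → ℝ) (F D : ℝ),
        (∀ z, |f z| ≤ F) → 0 ≤ D → (∀ z, f z ≠ 0 → D ≤ T P 0 x z) →
          |((tower P a msq).G k *ᵥ f) x|
              ≤ c₀ * P.spacing k ^ 2 * Real.exp (-(δ₀ * (D / (P.L : ℝ) ^ k))) * F ∧
          ∀ μ : Fin P.d, |((deriv P 0 P.eps μ * (tower P a msq).G k) *ᵥ f) x|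
              ≤ c₀ * P.spacing k * Real.exp (-(δ₀ * (D / (P.L : ℝ) ^ k))) * F := by
  obtain ⟨C, δ, hC, hδ, hK⟩ := kerBounds_torus d L hd hL ha msq
  -- the j = 0 constants depend on d, L, a, m² only; read them off any volume with these d, L
  have hP0 : ∃ P₀ : Params, P₀.d = d ∧ P₀.L = L := ⟨⟨d, L, 0, 0, hd, hL⟩, rfl, rfl⟩
  obtain ⟨P₀, hP₀d, hP₀L⟩ := hP0
  set C₀ := 2 / gamma0 L a with hC₀def
  set δ₀ := dK0 d L a msq with hδ₀def
  have hC₀ : 0 ≤ C₀ := by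
    rw [hC₀def, ← hP₀L]; exact (div_pos two_pos (gamma0_pos (P := P₀) ha)).le
  have hδ₀ : 0 < δ₀ := by rw [hδ₀def, ← hP₀d, ← hP₀L]; exact dK0_pos (P := P₀) ha hmsq
  have hL1 : (1 : ℝ) < L := by exact_mod_cast hL.2
  refine ⟨min (δ₀ / 2) (δ / 4),
    (max C₀ (2 * C₀ * Real.exp δ₀)) * B4Sect5Proof.latticeConst d (δ₀ / 2) + a ^ 2 * cTerm d C δ * (1 / ((L : ℝ) - 1)) + 1,
    lt_min (by positivity) (by positivity), ?_, ?_⟩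
  · have h1 := B4Sect5Proof.latticeConst_nonneg d (show 0 ≤ δ₀ / 2 by positivity)
    have h2 := cTerm_nonneg d hC hδ
    have h3 : 0 ≤ 1 / ((L : ℝ) - 1) := by apply div_nonneg zero_le_one; linarith
    positivity
  intro P hPd hPL k hk1 hkK x f F D hF hD0 hD
  have hkm : k ≤ P.m + P.K := hkK.trans (Nat.le_add_left _ _)
  have hcap : P.spacing k ^ 2 * msq ≤ msq := by
    have hs1 : P.spacing k ≤ 1 := by rw [← P.spacing_K]; exact spacing_le_spacing P hkK
    have hs0 := (P.spacing_pos k).le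
    calc P.spacing k ^ 2 * msq ≤ 1 * msq := mul_le_mul_of_nonneg_right (pow_le_one₀ hs0 hs1) hmsq
      _ = msq := one_mul _
  have hKB := hK P hPd hPL msq hmsq k hkm hcap
  subst hPd hPL
  have hG0 : ∀ x x' : Site P 0, |G0unit P a msq x x'| ≤ C₀ * Real.exp (-(δ₀ * T P 0 x x')) :=
    fun x x' => G0unit_decay (P := P) ha hmsq x x'
  have hF0 : 0 ≤ F := (abs_nonneg _).trans (hF x)
  have h1 := B4Sect5Proof.latticeConst_nonneg P.d (show 0 ≤ δ₀ / 2 by positivity)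
  have h2 := cTerm_nonneg P.d hC hδ
  have h3 : 0 ≤ 1 / ((P.L : ℝ) - 1) := by apply div_nonneg zero_le_one; linarith
  have hsk0 : 0 ≤ P.spacing k := (P.spacing_pos k).le
  have hE : 0 ≤ Real.exp (-(min (δ₀ / 2) (δ / 4) * (D / (P.L : ℝ) ^ k))) * F := mul_nonneg (Real.exp_pos _).le hF0
  set cBig := max C₀ (2 * C₀ * Real.exp δ₀) * B4Sect5Proof.latticeConst P.d (δ₀ / 2) +
    a ^ 2 * cTerm P.d C δ * (1 / ((P.L : ℝ) - 1)) + 1 with hcBig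
  have hv : C₀ * B4Sect5Proof.latticeConst P.d (δ₀ / 2) + a ^ 2 * cTerm P.d C δ * (1 / ((P.L : ℝ) - 1)) ≤ cBig := by
    have := mul_le_mul_of_nonneg_right (le_max_left C₀ (2 * C₀ * Real.exp δ₀)) h1
    rw [hcBig]; linarith
  have hdv : 2 * C₀ * Real.exp δ₀ * B4Sect5Proof.latticeConst P.d (δ₀ / 2) +
      a ^ 2 * cTerm P.d C δ * (1 / ((P.L : ℝ) - 1)) ≤ cBig := by
    have := mul_le_mul_of_nonneg_right (le_max_right C₀ (2 * C₀ * Real.exp δ₀)) h1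
    rw [hcBig]; linarith
  constructor
  · calc |((tower P a msq).G k *ᵥ f) x|
        ≤ (C₀ * B4Sect5Proof.latticeConst P.d (δ₀ / 2) + a ^ 2 * cTerm P.d C δ * (1 / ((P.L : ℝ) - 1))) *
            (P.spacing k ^ 2 * (Real.exp (-(min (δ₀ / 2) (δ / 4) * (D / (P.L : ℝ) ^ k))) * F)) := by
          rw [← mul_assoc, ← mul_assoc]
          exact value_row_bound_level P ha hmsq hk1 hkm hC hδ hC₀ hδ₀ hKB hG0 x f hF hD0 hD
      _ ≤ cBig * (P.spacing k ^ 2 * (Real.exp (-(min (δ₀ / 2) (δ / 4) * (D / (P.L : ℝ) ^ k))) * F)) :=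
          mul_le_mul_of_nonneg_right hv (mul_nonneg (by positivity) hE)
      _ = _ := by ring
  · intro μ
    calc |((deriv P 0 P.eps μ * (tower P a msq).G k) *ᵥ f) x|
        ≤ (2 * C₀ * Real.exp δ₀ * B4Sect5Proof.latticeConst P.d (δ₀ / 2) +
            a ^ 2 * cTerm P.d C δ * (1 / ((P.L : ℝ) - 1))) *
            (P.spacing k * (Real.exp (-(min (δ₀ / 2) (δ / 4) * (D / (P.L : ℝ) ^ k))) * F)) := by
          rw [← mul_assoc, ← mul_assoc]
          exact deriv_row_bound_level P ha hmsq hk1 hkm hC hδ hC₀ hδ₀ hKB hG0 μ x f hF hD0 hD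
      _ ≤ cBig * (P.spacing k * (Real.exp (-(min (δ₀ / 2) (δ / 4) * (D / (P.L : ℝ) ^ k))) * F)) :=
          mul_le_mul_of_nonneg_right hdv (mul_nonneg hsk0 hE)
      _ = _ := by ring

/-- **(1.10) IN LEVEL-`k` UNITS, KERNEL FORM** (the source `δ_y`): `|G^ε_k(x, y)| ≤ c₀(L^kε)²e^{−δ₀|x−y|_T/L^k}` and
`|(∂^ε_μG^ε_k)(x, y)| ≤ c₀(L^kε)e^{−δ₀|x−y|_T/L^k}` for all fine sites `x, y`, every volume and every `1 ≤ k ≤ K`.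
[cite: Balaban1983RegularityDecay, Theorem (1.10) p.573, η = L^{−k} p.572] -/
theorem thm110_zero_torus_level_kernel (d L : ℕ) (hd : 1 ≤ d) (hL : Odd L ∧ 1 < L) {a : ℝ} (ha : 0 < a) {msq : ℝ}
    (hmsq : 0 ≤ msq) :
    ∃ δ₀ c₀ : ℝ, 0 < δ₀ ∧ 0 < c₀ ∧ ∀ (P : Params), P.d = d → P.L = L →
      ∀ k : ℕ, 1 ≤ k → k ≤ P.K → ∀ (x y : Site P 0),
          |(tower P a msq).G k x y|
              ≤ c₀ * P.spacing k ^ 2 * Real.exp (-(δ₀ * (T P 0 x y / (P.L : ℝ) ^ k))) ∧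
          ∀ μ : Fin P.d, |(deriv P 0 P.eps μ * (tower P a msq).G k) x y|
              ≤ c₀ * P.spacing k * Real.exp (-(δ₀ * (T P 0 x y / (P.L : ℝ) ^ k))) := by
  obtain ⟨δ₀, c₀, hδ₀, hc₀, H⟩ := thm110_zero_torus_level d L hd hL ha hmsq
  refine ⟨δ₀, c₀, hδ₀, hc₀, fun P hPd hPL k hk1 hkK x y => ?_⟩
  have hF : ∀ z : Site P 0, |(Pi.single y (1 : ℝ) : Site P 0 → ℝ) z| ≤ 1 := fun z => by
    by_cases hz : z = y
    · subst hz; simp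
    · simp [hz]
  have hDs : ∀ z : Site P 0, (Pi.single y (1 : ℝ) : Site P 0 → ℝ) z ≠ 0 → T P 0 x y ≤ T P 0 x z := fun z hz => by
    by_cases hzy : z = y
    · rw [hzy]
    · exact absurd (by simp [hzy]) hz
  obtain ⟨h1, h2⟩ := H P hPd hPL k hk1 hkK x (Pi.single y 1) 1 (T P 0 x y) hF (T_nonneg P 0 x y) hDs
  refine ⟨?_, fun μ => ?_⟩
  · rw [mulVec_single_one, col_apply, mul_one] at h1
    exact h1
  · have h3 := h2 μ
    rw [mulVec_single_one, col_apply, mul_one] at h3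
    exact h3

/-- **(1.10) ON THE TORUS AT `A = 0`, VERBATIM, FOR B4's OWN OPERATOR `G_k(T_η, 0)` AND DIFFERENCE DERIVATIVE `D^η_μ`, `η = L^{−k}`.**
In the tower's vocabulary B4's `G_k(T_η, 0)` is the rescaled operator `G_k^{resc} = B5Display136Torus.Grs P a m² k =
(−Δ^η + (L^kε)²m² + a_kQ_k^*Q_k)^{−1}`, `η = ε/(L^kε) = L^{−k}` (`G^ε_k = (L^kε)²G_k^{resc}`: `G_eq_smul_Grs`), and `D^η_μ =
B1RG242Torus.deriv P 0 (ε/(L^kε)) μ` (`= η^{−1}(shift − 1)`).  For `d ≥ 1`, odd `L > 1`, `a > 0`, `m² ≥ 0` there are `δ₀, c₀ > 0` (of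
`d, L, a, m²` only) such that for every volume, every `1 ≤ k ≤ K`, every `x`, `μ` and every `f` with `|f| ≤ F` vanishing within fine
distance `D ≥ 0` of `x`:  `|(G_k^{resc}f)(x)| ≤ c₀e^{−δ₀D/L^k}F` and `|(D^η_μG_k^{resc}f)(x)| ≤ c₀e^{−δ₀D/L^k}F`, where `D/L^k = ηD =
dist_η(x, supp f)` — «|(D^η_μG_k(Ω,A)f)(x)|, |(G_k(Ω,A)f)(x)| ≤ c₀exp(−δ₀dist(x, supp f))‖f‖_∞ (1.10)» with «δ₀, c₀ … independent of A,
k, Ω», at `Ω = T_η`, `A = 0`, no restriction on `x`. [cite: Balaban1983RegularityDecay, Theorem (1.10) p.573, (1.6) and η = L^{−k}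
p.572, p.573 («for rectangular parallelepipeds … for all x»); Balaban1982Higgs1, (2.30)–(2.31) p.611 (the rescaling)] -/
theorem thm110_zero_torus_resc (d L : ℕ) (hd : 1 ≤ d) (hL : Odd L ∧ 1 < L) {a : ℝ} (ha : 0 < a) {msq : ℝ}
    (hmsq : 0 ≤ msq) :
    ∃ δ₀ c₀ : ℝ, 0 < δ₀ ∧ 0 < c₀ ∧ ∀ (P : Params), P.d = d → P.L = L →
      ∀ k : ℕ, 1 ≤ k → k ≤ P.K → ∀ (x : Site P 0) (f : Site P 0 → ℝ) (F D : ℝ),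
        (∀ z, |f z| ≤ F) → 0 ≤ D → (∀ z, f z ≠ 0 → D ≤ T P 0 x z) →
          |(Grs P a msq k *ᵥ f) x| ≤ c₀ * Real.exp (-(δ₀ * (D / (P.L : ℝ) ^ k))) * F ∧
          ∀ μ : Fin P.d, |((deriv P 0 (P.eps / P.spacing k) μ * Grs P a msq k) *ᵥ f) x|
              ≤ c₀ * Real.exp (-(δ₀ * (D / (P.L : ℝ) ^ k))) * F := by
  obtain ⟨δ₀, c₀, hδ₀, hc₀, H⟩ := thm110_zero_torus_level d L hd hL ha hmsq
  refine ⟨δ₀, c₀, hδ₀, hc₀, fun P hPd hPL k hk1 hkK x f F D hF hD0 hD => ?_⟩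
  obtain ⟨h1, h2⟩ := H P hPd hPL k hk1 hkK x f F D hF hD0 hD
  have hs : P.spacing k ≠ 0 := (P.spacing_pos k).ne'
  have hs0 : 0 < P.spacing k := P.spacing_pos k
  have hε : P.eps ≠ 0 := P.eps_pos.ne'
  -- `Grs_k = (L^kε)^{−2}·G^ε_k`
  have hGrs : Grs P a msq k = (P.spacing k ^ 2)⁻¹ • (tower P a msq).G k := by
    rw [G_eq_smul_Grs (P := P) ha hmsq hk1, inv_smul_smul₀ (pow_ne_zero 2 hs)]
  have hval : (Grs P a msq k *ᵥ f) x = (P.spacing k ^ 2)⁻¹ * ((tower P a msq).G k *ᵥ f) x := by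
    rw [hGrs, smul_mulVec, Pi.smul_apply, smul_eq_mul]
  refine ⟨?_, fun μ => ?_⟩
  · rw [hval, abs_mul, abs_of_nonneg (by positivity)]
    calc (P.spacing k ^ 2)⁻¹ * |((tower P a msq).G k *ᵥ f) x|
        ≤ (P.spacing k ^ 2)⁻¹ * (c₀ * P.spacing k ^ 2 * Real.exp (-(δ₀ * (D / (P.L : ℝ) ^ k))) * F) :=
          mul_le_mul_of_nonneg_left h1 (by positivity)
      _ = _ := by field_simp
  · -- `D^η_μG_k^{resc} = (L^kε)^{−1}·∂^ε_μG^ε_k`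
    have hder : ((deriv P 0 (P.eps / P.spacing k) μ * Grs P a msq k) *ᵥ f) x
        = (P.spacing k)⁻¹ * ((deriv P 0 P.eps μ * (tower P a msq).G k) *ᵥ f) x := by
      rw [← mulVec_mulVec, deriv_mulVec, ← mulVec_mulVec, deriv_mulVec, hGrs, smul_mulVec, Pi.smul_apply,
        Pi.smul_apply, smul_eq_mul, smul_eq_mul]
      field_simp
    rw [hder, abs_mul, abs_of_nonneg (by positivity)]
    calc (P.spacing k)⁻¹ * |((deriv P 0 P.eps μ * (tower P a msq).G k) *ᵥ f) x|
        ≤ (P.spacing k)⁻¹ * (c₀ * P.spacing k * Real.exp (-(δ₀ * (D / (P.L : ℝ) ^ k))) * F) :=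
          mul_le_mul_of_nonneg_left (h2 μ) (by positivity)
      _ = _ := by field_simp

end Uniform

end B4Thm110ZeroTorusLevel

end Literature.MathematicalPhysics.QuantumFieldTheory.Balaban1983to89
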